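import Mathlib.Algebra.BigOperators.Fin
import Mathlib.Algebra.MvPolynomial.Basic
import Mathlib.Data.Complex.Basic
import Mathlib.Data.Nat.Choose.Basic
import Literature.Computability.AlgebraicComplexity.StandardFamilies
import Literature.Computability.AlgebraicComplexity.HessianAtOrigin
import HarnessLib

/-!
# Crux `GrenetZeon.HessianRankCodimTwo` (stmt-ValiantsHypothesis-8061), line `good_plane`,
# stub `stub_goodPlanes` for ALL large `n` — the BORDERED LATIN PLANE with one pencil border block: definitions

The registered stub `stub_goodPlanes : ∃ n₀, ∀ n ≥ n₀, GoodPlane n` of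
`Cruxes/HessianRankCodimTwo/Lines/good_plane.lean` is known for `n = 3p`, `p` prime `≥ 13` (Theorem P,
`Theorems/GrenetZeonHessianRankCodimTwoLatinGoodPlaneThreePrime.lean`).  For ALL large `n` we write
`n = 3p + r` with `p` prime in `(n/3.15, n/3]` (the tree has primes in every `(x, 1.05x]`, `x ≥ 10⁸`:
`Literature/NumberTheory/LFunctions/FordPrimeWindowsPNT.lean`), so `0 ≤ r < 0.15p`, and use the following
plane of `n × n` matrices (memo `Cruxes/HessianRankCodimTwo/BorderedLatinAllN.md`, val-width-8061-p1 g2):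
three CORE blocks `B_0, B_1, B_2` of size `p` and one BORDER block of size `r` (rows and columns alike;
blocks are indexed by `Option (Fin 3)`, `none` = border); the point with coordinates `a = (a_0,a_1,a_2)` is
block-constant, block `(I, J)` carrying the linear form `L_{IJ}(a) = Σ_d bordCoef I J d · a_d`:

* core `L_{IJ} = a_{J-I}` (the Latin/circulant core of Theorem P),
* border column `L_{I,none} = u_I(a)`, border row `L_{none,J} = v_J(a)`, corner `L_{none,none} = w(a)`, with the
  PENCIL DESIGN `u = (2a_0+a_1, a_0+a_1, 3a_0+2a_1)`, `v = (3a_0+5a_1, 4a_0+5a_1, a_0-2a_1)` (six distinct lines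
  through `[0:0:1]`) and `w = -4a_0 + 2a_1 + a_2` (found by the exact checker `design_check.py` of the seat;
  `≈ 280` integer non-degeneracy conditions, all non-zero, largest `≈ 2.9·10¹⁴`).

Modulo `p` the permanent of the point is `(p!)³ r! · F(a)^p w(a)^r` and the nine CORE block values (the
Hessian eigenvalues of `…BlockEigen.lean`) are `(p-2)! p!² r! · P_d(a)^p · bordLow` with
`bordLow ≡ a_d^{p-2-r} (a_d w - u_I v_J)^{r-1} (a_d w - (r+1) u_I v_J)` (`d = J - I`; proved in the
`…BorderFrobenius*` / `…BorderTable*` files), and a characteristic-`p` count shows that at most four of the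
nine vanish on the curve, whence `rank Hess ≥ 5(p-1)² > (3p+r)²/2` for `r < 0.16p` (`…BorderPlane.lean`,
`…BorderDeaths*.lean`).

This file fixes the definitions only (single source of truth `bordCoef` for both the complex matrices and
the generating functions).  Generating functions live in `MvPolynomial (Option (Fin 3)) (MvPolynomial (Fin 3) R)`
(outer variables `y_J`, `J : Option (Fin 3)`; inner variables the three coordinates).  Nothing is proved here.
VP ≠ VNP is not moved: the crux only feeds the constant-factor bound `TwoDimCoefficients`.
-/

noncomputable section

open MvPolynomial Finset
open Literature.Computability.AlgebraicComplexity

-- single-conjunct layout `Summits/ValiantsHypothesis/ValiantsHypothesis`: duplicated namespace by design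
set_option linter.dupNamespace false

namespace Summit.ValiantsHypothesis.ValiantsHypothesis.Theorems.GrenetZeonHessianRankCodimTwo

/-! ### The integer design -/

/-- Coefficients of the border COLUMN forms `u_I = Σ_d bordU I d · a_d`:
`u_0 = 2a_0 + a_1`, `u_1 = a_0 + a_1`, `u_2 = 3a_0 + 2a_1`. [folklore] -/
def bordU : Fin 3 → Fin 3 → ℤ := ![![2, 1, 0], ![1, 1, 0], ![3, 2, 0]]

/-- Coefficients of the border ROW forms `v_J = Σ_d bordV J d · a_d`:
`v_0 = 3a_0 + 5a_1`, `v_1 = 4a_0 + 5a_1`, `v_2 = a_0 - 2a_1`. [folklore] -/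
def bordV : Fin 3 → Fin 3 → ℤ := ![![3, 5, 0], ![4, 5, 0], ![1, -2, 0]]

/-- Coefficients of the CORNER form `w = -4a_0 + 2a_1 + a_2`. [folklore] -/
def bordW : Fin 3 → ℤ := ![-4, 2, 1]

/-- The coefficient of `a_d` in the linear form `L_{IJ}` carried by block `(I, J)` of the bordered Latin
plane (`none` = the border block): core `a_{J-I}`, border column `u_I`, border row `v_J`, corner `w`.
[folklore] -/
def bordCoef : Option (Fin 3) → Option (Fin 3) → Fin 3 → ℤ
  | some I, some J, d => if J - I = d then 1 else 0
  | some I, none, d => bordU I d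
  | none, some J, d => bordV J d
  | none, none, d => bordW d

/-! ### The plane of `(3p + r) × (3p + r)` matrices -/

/-- The block of a row/column index of `Fin (3p + r)`: `some ⌊i/p⌋` for `i < 3p` (core), `none` for the
last `r` indices (border). [folklore] -/
def bordBlk (p r : ℕ) (i : Fin (3 * p + r)) : Option (Fin 3) :=
  if h : i.val < 3 * p then
    some ⟨i.val / p, by
      rcases Nat.eq_zero_or_pos p with h0 | h0
      · omega
      · exact (Nat.div_lt_iff_lt_mul h0).mpr (by omega)⟩
  else none

/-- The three basis matrices of the bordered Latin plane of size `n = 3p + r`: the `(i, j)` entry of the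
`d`-th one is `bordCoef (block i) (block j) d`. [folklore] -/
def bordBasis (p r : ℕ) (d : Fin 3) : Fin (3 * p + r) × Fin (3 * p + r) → ℂ := fun ij =>
  (bordCoef (bordBlk p r ij.1) (bordBlk p r ij.2) d : ℂ)

/-- The point of the bordered Latin plane with coordinates `a`: entry `(i, j)` is
`L_{block i, block j}(a)`. [folklore] -/
def bordPoint (p r : ℕ) (a : Fin 3 → ℂ) : Fin (3 * p + r) × Fin (3 * p + r) → ℂ :=
  ∑ d, a d • bordBasis p r d

/-- Row/column index number `s ∈ {0, 1}` of core block `I`, as an element of `Fin (3p + r)` (`p ≥ 2`).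
[folklore] -/
def bordIdx (p r : ℕ) (hp : 2 ≤ p) (I : Fin 3) (s : Fin 2) : Fin (3 * p + r) :=
  ⟨I.val * p + s.val, by have := I.isLt; have := s.isLt; nlinarith⟩

/-- The CORE BLOCK VALUE `h_{IJ}(a)` (`I, J : Fin 3`): the Hessian entry of `per_n` at the point with
coordinates `a` at the positions (row `I·p`, column `J·p`), (row `I·p + 1`, column `J·p + 1`) — the
`(n-2) × (n-2)` sub-permanent with two rows of core block `I` and two columns of core block `J` removed
(`hess0_transl_perPoly`), the eigenvalue of `…BlockEigen.lean` on `V_I ⊠ V_J`. [folklore] -/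
def bordBlockValue (p r : ℕ) (hp : 2 ≤ p) (a : Fin 3 → ℂ) (I J : Fin 3) : ℂ :=
  hess0 (transl (bordPoint p r a) (perPoly (Fin (3 * p + r)) ℂ))
    (bordIdx p r hp I 0, bordIdx p r hp J 0) (bordIdx p r hp I 1, bordIdx p r hp J 1)

/-- **(★★) Core non-vanishing at size `(p, r)`.** At every point of the bordered Latin plane of size
`n = 3p + r` on the permanental hypersurface, at least five of the nine CORE block values are non-zero.
(Proved for all primes `p` beyond an explicit bound and `1 ≤ r ≤ p - 3` in the `…Border*` files; with
`10 (p-1)² > (3p+r)²` it gives `GoodPlane (3p + r)`.) [folklore] -/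
def BordCoreNonvanishing (p r : ℕ) : Prop :=
  ∀ hp : 2 ≤ p, ∀ a : Fin 3 → ℂ, a ≠ 0 →
    MvPolynomial.eval (bordPoint p r a) (perPoly (Fin (3 * p + r)) ℂ) = 0 →
      5 ≤ (Finset.univ.filter fun IJ : Fin 3 × Fin 3 => bordBlockValue p r hp a IJ.1 IJ.2 ≠ 0).card

/-! ### Generating functions (over a commutative ring `R`) -/

section GF

variable (R : Type*) [CommRing R]

/-- The linear form `L_{IJ}` of block `(I, J)` as a polynomial in the three coordinates. [folklore] -/
def bordEnt (I J : Option (Fin 3)) : MvPolynomial (Fin 3) R :=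
  ∑ d : Fin 3, (bordCoef I J d : MvPolynomial (Fin 3) R) * X d

/-- The ROW FORM of block row `I`: `ℓ_I(y) = Σ_J L_{IJ} · y_J`, linear in the outer variables `y_J`,
`J : Option (Fin 3)`, with coefficients in the inner ring `R[a_0,a_1,a_2]`. [folklore] -/
def bordRowForm (I : Option (Fin 3)) : MvPolynomial (Option (Fin 3)) (MvPolynomial (Fin 3) R) :=
  ∑ J : Option (Fin 3), C (bordEnt R I J) * X J

/-- The exponent vector `(p, p, p; r)` of the permanent table: every core colour `p` times, the border
colour `r` times. [folklore] -/
def bordNuPer (p r : ℕ) : Option (Fin 3) →₀ ℕ :=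
  (∑ K : Fin 3, Finsupp.single (some K) p) + Finsupp.single none r

/-- The exponent vector `(p, p, p; r) - 2e_J` of the core block table `(·, J)`. [folklore] -/
def bordNuBlock (p r : ℕ) (J : Fin 3) : Option (Fin 3) →₀ ℕ :=
  (∑ K : Fin 3, Finsupp.single (some K) (if K = J then p - 2 else p)) + Finsupp.single none r

/-- `Φ := [y^{(p,p,p;r)}] ℓ_0^p ℓ_1^p ℓ_2^p ℓ_{none}^r`: the permanent of the bordered Latin point divided by
`(p!)³ r!`, as a generating-function coefficient. [folklore] -/
def bordPhi (p r : ℕ) : MvPolynomial (Fin 3) R :=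
  coeff (bordNuPer p r)
    ((∏ I : Fin 3, bordRowForm R (some I) ^ p) * bordRowForm R none ^ r)

/-- `Ψ_{IJ} := [y^{(p,p,p;r) - 2e_J}] ℓ_I^{p-2} ℓ_{I+1}^p ℓ_{I+2}^p ℓ_{none}^r`: the core block value `(I, J)`
divided by `(p-2)!·p!·p!·r!`, as a generating-function coefficient (intended for `p ≥ 2`). [folklore] -/
def bordPsi (p r : ℕ) (I J : Fin 3) : MvPolynomial (Fin 3) R :=
  coeff (bordNuBlock p r J)
    (bordRowForm R (some I) ^ (p - 2) *
      (bordRowForm R (some (I + 1)) ^ p * bordRowForm R (some (I + 2)) ^ p) * bordRowForm R none ^ r)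

/-- The LOW-DIGIT SUM of the core block congruence:
`Σ_{t ≤ r} C(p-2,t)·C(r,t) · a_d^{p-2-t} (u_I v_J)^t w^{r-t}`, `d = J - I` — the coefficient of
`y_J^{p-2} y_{none}^r` in `ℓ_I^{p-2} ℓ_{none}^r`; modulo `p` it equals
`a_d^{p-2-r} (a_d w - u_I v_J)^{r-1} (a_d w - (r+1) u_I v_J)` for `1 ≤ r ≤ p - 2`. [folklore] -/
def bordLow (p r : ℕ) (I J : Fin 3) : MvPolynomial (Fin 3) R :=
  ∑ t ∈ Finset.range (r + 1),
    (((p - 2).choose t * r.choose t : ℕ) : MvPolynomial (Fin 3) R) *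
      (X (J - I) ^ (p - 2 - t) * (bordEnt R (some I) none * bordEnt R none (some J)) ^ t *
        bordEnt R none none ^ (r - t))

end GF

end Summit.ValiantsHypothesis.ValiantsHypothesis.Theorems.GrenetZeonHessianRankCodimTwo
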